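import Literature.NumberTheory.EllipticCurves.UniversalOrdinaryKernelPolynomialProofs
import Literature.NumberTheory.EllipticCurves.CanonicalSubgroupNormProofs
import Literature.NumberTheory.EllipticCurves.UniversalOrdinaryFunctionalEquation
import HarnessLib

/-!
# The candidate `φ_ψ = p·D` for the universal ordinary curve from the even Weierstrass factor of
# `[p]` (towards Blakestad–Grant 2023, Prop. 7 (a) / eq. (4) — proofs only)

Trunk T-NT-EC (Literature/NumberTheory/EllipticCurves). Assembly of
`UniversalOrdinaryKernelPolynomialProofs.exists_evenWeierstrassFactor` (`[p](t) = t·e⁺(t²)·v⁺(t²)`,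
`ξ = e⁺Q + w`) with `CanonicalSubgroupNormProofs.kernelPolynomial_of_distinguished` (the determinant
form `φ = (-1)ⁿc⁻¹·det(X·M_{q̄} - M_{w̄})`): **`exists_kernelPolynomialCandidate`** — a polynomial
`φ ∈ R̂[X]` of degree `≤ n = (p-1)/2` with `p ∣ [Xᵏ]φ` (`k ≥ 1`) and `[X⁰]φ ∈ R̂ˣ` (the shape of
Blakestad–Grant's (4), `φ_ψ ≡ ℓ̃₀ (mod p)`), which over every field `F ⊇ R̂` in which `e⁺` has `n`
distinct roots `qⱼ` factors as `φ = p·∏ⱼ(X - w(qⱼ)/qⱼ)` with `[Xⁿ]φ = p`. On Blakestad–Grant's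
reading (our gloss) the `qⱼ = t(u)²` are the squared parameters of the non-zero points `u` of the
canonical subgroup and `w(qⱼ)/qⱼ = x(u)`, so `φ = φ_ψ = p·D`; that identification (points of the
canonical subgroup) is not made here.

## Sources

* C. Blakestad, D. Grant, J. Number Theory 249 (2023) (arXiv:1903.02480), Prop. 7 (a), eq. (4).
  [BlakestadGrant2023]

Pure proof file: no definitions, no named facts.
-/

noncomputable section

open PowerSeries Literature.NumberTheory.EllipticCurves.CanonicalSubgroupNorm
open scoped Polynomial

namespace Literature.NumberTheory.EllipticCurves.UniversalOrdinary

variable (p : ℕ) [Fact p.Prime]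

/-- **The candidate `φ_ψ` of the universal ordinary curve** (`p ≥ 5`): with `e⁺, v⁺, ξ, Q, w` as in
`exists_evenWeierstrassFactor` and `φ := (-1)ⁿc⁻¹·Φ_w` (`CanonicalSubgroupNormProofs`):
`deg φ ≤ n`, `p ∣ [Xᵏ]φ` for `k ≥ 1`, `[X⁰]φ ∈ R̂ˣ`; and for every field `F`, injective
`f : R̂ → F` and `n` distinct roots `qⱼ` of `e⁺` in `F` with `e⁺ = ∏(X - qⱼ)`:
`φ = p·∏ⱼ(X - w(qⱼ)/qⱼ)` in `F[X]` and `[Xⁿ]φ = p`. [Blakestad–Grant 2023, Prop. 7 (a), eq. (4)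
(the shape of `φ_ψ = pD`)] [cite: BlakestadGrant2023, Prop. 7, eq. (4)] -/
theorem exists_kernelPolynomialCandidate (hp5 : 5 ≤ p) :
    ∃ (e : (completeRing p)[X]) (v : PowerSeries (completeRing p)) (ξ Q : PowerSeries (completeRing p))
      (w φ : (completeRing p)[X]),
      2 * e.natDegree + 1 = p ∧ e.Monic ∧ IsUnit v ∧
      (universalCurve p).formalMul p = X * expand 2 two_ne_zero ((e : PowerSeries (completeRing p)) * v) ∧
      (universalCurve p).formalXMulSq = expand 2 two_ne_zero ξ ∧
      ξ = (e : PowerSeries (completeRing p)) * Q + w ∧ w.degree < e.natDegree ∧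
      φ.natDegree ≤ e.natDegree ∧ (∀ k, 1 ≤ k → (p : completeRing p) ∣ φ.coeff k) ∧ IsUnit (φ.coeff 0) ∧
      ∀ (F : Type) [Field F] (f : completeRing p →+* F), Function.Injective f →
        ∀ (q : Fin e.natDegree → F), Function.Injective q → e.map f = ∏ j, (Polynomial.X - Polynomial.C (q j)) →
          φ.map f = Polynomial.C (f p) * ∏ j, (Polynomial.X - Polynomial.C (w.eval₂ f (q j) / q j)) ∧
            φ.coeff e.natDegree = p := by
  obtain ⟨n, hnp, e, v, c, ξ, Q, w, he, hdeg, hv, hmul, hc, he0, hXξ, _hξ0, hweq, hwdeg, hw0⟩ :=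
    exists_evenWeierstrassFactor p hp5
  subst hdeg
  have hg : e.Monic := he.monic
  have hgI : ∀ k < e.natDegree, e.coeff k ∈ Ideal.span {(p : completeRing p)} := fun k hk =>
    he.toIsWeaklyEisensteinAt.mem hk
  set ci : completeRing p := ↑hc.unit⁻¹ with hci
  set φ : (completeRing p)[X] := Polynomial.C ((-1) ^ e.natDegree * ci) * normForm hg w with hφ
  -- congruences mod `p` from `normForm_map_mk`
  have hmod := normForm_map_mk hg hgI w
  have hcoeff : ∀ k, Ideal.Quotient.mk (Ideal.span {(p : completeRing p)}) ((normForm hg w).coeff k) =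
      if k = 0 then Ideal.Quotient.mk (Ideal.span {(p : completeRing p)}) ((-w.coeff 0) ^ e.natDegree) else 0 := by
    intro k
    have h := congrArg (fun P => Polynomial.coeff P k) hmod
    simp only [Polynomial.coeff_map, Polynomial.coeff_C] at h
    exact h
  have hdvd : ∀ k, 1 ≤ k → (p : completeRing p) ∣ φ.coeff k := by
    intro k hk
    have hk' := hcoeff k
    rw [if_neg (by omega), Ideal.Quotient.eq_zero_iff_mem] at hk'
    rw [hφ, Polynomial.coeff_C_mul]
    exact Ideal.mem_span_singleton.mp (Ideal.mul_mem_left _ _ hk')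
  have hunit : IsUnit (φ.coeff 0) := by
    refine Literature.RingTheory.AdicTopology.isUnit_of_isUnit_mk (Ideal.span {(p : completeRing p)}) ?_
    rw [hφ, Polynomial.coeff_C_mul, map_mul, hcoeff 0, if_pos rfl, ← map_mul]
    refine IsUnit.map _ ?_
    exact ((isUnit_one.neg.pow _).mul (Units.isUnit _)).mul (hw0.neg.pow _)
  have hdegφ : φ.natDegree ≤ e.natDegree :=
    (Polynomial.natDegree_C_mul_le _ _).trans (natDegree_normForm_le hg w)
  refine ⟨e, v, ξ, Q, w, φ, hnp, hg, hv, hmul, hXξ, hweq, hwdeg, hdegφ, hdvd, hunit, ?_⟩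
  intro F _ f hf q hq hsplit
  obtain ⟨hfac, -, hlead, -, -⟩ := kernelPolynomial_of_distinguished hg hc he0 hgI w f hf (natCast_prime_ne_zero p hp5) hq hsplit
  exact ⟨hfac, hlead⟩

end Literature.NumberTheory.EllipticCurves.UniversalOrdinary
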